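import Summits.ABC.IUTFork.Repair.RcatZhouTwoTorsion
import Summits.ABC.IUTFork.Repair.RcatZhou2Torsion
import HarnessLib

/-!
# D-0123(C) IUT REPAIR-CATALOGUE, row RC-441 (Zhou «2-torsion initial Θ-data»): CONCORDANCE of the two independent
# kernel files — abc-iut-rcat-tst-7's `Repair/RcatZhou2Torsion` (p523627, K-line file of record) and
# abc-iut-rcat-tst-8's `Repair/RcatZhouTwoTorsion` (p523979, the datum class as a structure)

PROOF-ONLY record file (D-0012) of the abc-iut cell (seat abc-iut-rcat-tst-8 gen 4, at the KEY holder rcat-tst-7's invitation,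
STATUS 10:34:41Z); count-neutral; TAKES NO SIDE on [IUTchIII] Cor. 3.12 / [IUTchIV] Thm. 1.10, on Z.-P. Zhou or any author
(D-0045); nothing here asserts abc proved or refuted; typed ≠ proved.

The two files type Zhou's added clause "`E_F` has a model over `F_mod`" (arXiv:2510.05448 §2.1 Def. 2.1) in two
spellings — tst-8: `HasModelOverFieldOfModuli E := ∃ E₀ c, E = c • E₀.baseChange F`; tst-7 (inline):
`∃ E₀ C₀, C₀ • E = E₀.map (algebraMap (fieldOfModuli E) F)` — and each proves "`K` is Galois over `F_mod`" without any
torsion input (`RcatZhouTwoTorsion.kGalois_of_exists_model`, `RcatZhou2Torsion.kGalois_of_model`). This file records, in the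
kernel, that (1) the two spellings are EQUIVALENT (`C₀ = c⁻¹`; `baseChange` is `map (algebraMap _ _)` by definition), and
(2) each file's K-Galois theorem yields the other's, on tst-8's structure `TwoTorsionInitialThetaData` and on bare
hypotheses. Nothing new is claimed; no definition, instance or named fact is introduced.
-/

noncomputable section

open scoped Classical
open WeierstrassCurve

namespace Summit.ABC.IUTFork.Repair.RcatZhouTwoTorsion

open Literature.IUT.HodgeTheaters

universe u v w

variable {F : Type u} {K : Type v} {Fbar : Type w} [Field F] [NumberField F] [Field K] [NumberField K]
  [Algebra F K] [Field Fbar] [Algebra F Fbar] [Algebra K Fbar] {E : WeierstrassCurve F} [E.IsElliptic] {l : ℕ}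

omit [NumberField K] [Algebra F K] [Algebra F Fbar] [Algebra K Fbar] in
/-- **The two spellings of "`E_F` has a model over `F_mod`" agree**: tst-8's `HasModelOverFieldOfModuli E`
(`E = c • E₀ ⊗ F`) ↔ tst-7's inline clause (`C₀ • E = E₀ ⊗ F`), with `C₀ = c⁻¹`. [folklore] -/
theorem hasModelOverFieldOfModuli_iff :
    HasModelOverFieldOfModuli E ↔
      ∃ (E₀ : WeierstrassCurve (fieldOfModuli E)) (C₀ : VariableChange F),
        C₀ • E = E₀.map (algebraMap (fieldOfModuli E) F) := by
  constructor
  · rintro ⟨E₀, c, hE⟩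
    refine ⟨E₀, c⁻¹, ?_⟩
    calc c⁻¹ • E = c⁻¹ • (c • E₀.baseChange F) := congrArg (c⁻¹ • ·) hE
      _ = E₀.map (algebraMap (fieldOfModuli E) F) := inv_smul_smul c _
  · rintro ⟨E₀, C₀, h⟩
    refine ⟨E₀, C₀⁻¹, ?_⟩
    calc E = C₀⁻¹ • (C₀ • E) := (inv_smul_smul C₀ E).symm
      _ = C₀⁻¹ • E₀.baseChange F := congrArg (C₀⁻¹ • ·) h

omit [NumberField K] in
/-- tst-7's `kGalois_of_model` RE-DERIVED from tst-8's `kGalois_of_exists_model` (same statement, tst-7's hypothesis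
spelling). [folklore] -/
theorem kGalois_of_model' [IsScalarTower F K Fbar] [hGal : IsGalois (fieldOfModuli E) F]
    (hK : ∀ z : Fbar, z ∈ Set.range (algebraMap K Fbar) ↔ ∀ τ : Fbar ≃ₐ[F] Fbar, FixesTorsion E l τ → τ z = z)
    (E₀ : WeierstrassCurve (fieldOfModuli E)) (C₀ : VariableChange F)
    (hmodel : C₀ • E = E₀.map (algebraMap (fieldOfModuli E) F)) (σ : Fbar ≃+* Fbar)
    (hσ : ∀ x : fieldOfModuli E, σ (algebraMap F Fbar (x : F)) = algebraMap F Fbar (x : F)) (y : K) :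
    σ (algebraMap K Fbar y) ∈ Set.range (algebraMap K Fbar) :=
  kGalois_of_exists_model hGal (hasModelOverFieldOfModuli_iff.2 ⟨E₀, C₀, hmodel⟩) hK σ hσ y

omit [NumberField K] [Algebra F K] in
/-- tst-8's `kGalois_of_exists_model` RE-DERIVED from tst-7's `RcatZhou2Torsion.kGalois_of_model` (same statement,
tst-8's hypothesis spelling). [folklore] -/
theorem kGalois_of_exists_model' (hGal : IsGalois (fieldOfModuli E) F) (hmod : HasModelOverFieldOfModuli E)
    (hK : ∀ x : Fbar, x ∈ Set.range (algebraMap K Fbar) ↔ ∀ σ : Fbar ≃ₐ[F] Fbar, FixesTorsion E l σ → σ x = x)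
    (σ : Fbar ≃+* Fbar)
    (hσ : ∀ x : fieldOfModuli E, σ (algebraMap F Fbar (x : F)) = algebraMap F Fbar (x : F)) (y : K) :
    σ (algebraMap K Fbar y) ∈ Set.range (algebraMap K Fbar) := by
  haveI := hGal
  obtain ⟨E₀, C₀, hmodel⟩ := hasModelOverFieldOfModuli_iff.1 hmod
  exact RcatZhou2Torsion.kGalois_of_model hK E₀ C₀ hmodel σ hσ y

variable {P : BadPlacePredicates K}

/-- On the typed datum class: tst-8's `TwoTorsionInitialThetaData.kGaloisOverFieldOfModuli_holds` obtained through
tst-7's file instead — the K-line file of record (p523627) and the structure file (p523979) prove the SAME typed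
statement for every 2-torsion initial Θ-datum. [claim: ZhouIUT2025b, status: disputed] -/
theorem TwoTorsionInitialThetaData.kGaloisOverFieldOfModuli_holds_via_tst7
    (D : TwoTorsionInitialThetaData F K Fbar E l P) : D.KGaloisOverFieldOfModuli := fun σ hσ y =>
  kGalois_of_exists_model' D.isGalois_fieldOfModuli D.exists_model_fieldOfModuli D.range_K_iff σ hσ y

/-- Conversely tst-7's corollary on L5-t2's interface, `RcatZhou2Torsion.kGaloisOverFieldOfModuli_of_model`, obtained
through tst-8's structure route (`ofInitialThetaData` + `kGaloisOverFieldOfModuli_holds`). [claim: ZhouIUT2025b, status: disputed] -/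
theorem kGaloisOverFieldOfModuli_of_model_via_tst8 (D : InitialThetaData F K Fbar E l P)
    (E₀ : WeierstrassCurve (fieldOfModuli E)) (C₀ : VariableChange F)
    (hmodel : C₀ • E = E₀.map (algebraMap (fieldOfModuli E) F)) : D.KGaloisOverFieldOfModuli :=
  kGaloisOverFieldOfModuli_of_exists_model D (hasModelOverFieldOfModuli_iff.2 ⟨E₀, C₀, hmodel⟩)

end Summit.ABC.IUTFork.Repair.RcatZhouTwoTorsion

end
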